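import Literature.Combinatorics.StablePolynomials.StableDiagonalFactorization
import Literature.Combinatorics.StablePolynomials.RightHalfPlaneStabilityPreservers
import HarnessLib

/-!
# Hard Pólya–Schur theory: bounded degree multiplier sequences (Borcea–Brändén II, §4, Thm. 4.5 and Cor. 4.6)

J. Borcea, P. Brändén, *The Lee–Yang and Pólya–Schur programs. II. Theory of stable polynomials and
applications*, Comm. Pure Appl. Math. 62 (2009) 1595–1631 (arXiv:0809.3087), §4:

> Given `κ ∈ ℕⁿ` we say that a sequence `{λ(α)}_{α ≤ κ}` of real numbers is a `κ`-multiplier sequence if the linear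
> operator `T : ℝ_κ[z_1,…,z_n] → ℝ_κ[z_1,…,z_n]` defined by `T(z^α) = λ(α)z^α`, `α ≤ κ`, preserves real stability.
> […]
> **Theorem 4.5.** Let `κ ∈ ℕⁿ`, let `λ := {λ(α)}_{α ≤ κ}` be a sequence of real numbers and `T : ℝ_κ[z] → ℝ_κ[z]`
> be the corresponding linear operator. The following are equivalent: (a) `λ` is a `κ`-multiplier sequence;
> (b) `±λ` is the product of one-dimensional `κ_i`-multiplier sequences that are either all alternating in sign or
> all non-negative […]; (c) Either `T[(z+w)^κ] ∈ 𝓗_{2n}(ℝ)` or `T[(z-w)^κ] ∈ 𝓗_{2n}(ℝ)`; (d) `T[(z+w)^κ]` or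
> `T[(z-w)^κ]` can be written as `f_1(z_1w_1)⋯f_n(z_nw_n)`, where `f_1(t),…,f_n(t)` are univariate polynomials
> with real zeros only, and all these zeros have the same sign (collectively). *Proof.* This is an immediate
> consequence of Theorem 4.4 and Lemma 4.3.
> **Remark 4.1.** Note that the `κ`-multiplier sequences with constant sign are precisely the sequences whose
> corresponding operators preserve stability.
> **Corollary 4.6.** Let `κ ∈ ℕⁿ`, `λ := {λ(α)}_{α ≤ κ}` be a sequence of complex numbers and `T : ℂ_κ[z] → ℂ_κ[z]`
> be the corresponding linear operator. Then `T` preserves weak Hurwitz stability if and only if `λ` is (a constant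
> complex multiple of) a non-negative `κ`-multiplier sequence. *Proof.* By Theorem 3.2 `T` preserves weak Hurwitz
> stability if and only if the polynomial `T[(z+w)^κ] = Σ_{α ≤ κ} binom(κ,α) λ(α) z^α w^{κ-α}` is weakly Hurwitz
> stable, which occurs exactly when `Σ_{α ≤ κ} (-1)^α binom(κ,α) λ(α) z^α w^α` is stable. The assertion now follows
> from Lemma 4.3 and Remark 4.1.

This file formalises these statements on top of Lemma 4.3 (`isUpperHalfPlaneStable_diagSubst_iff`,
`StableDiagonalFactorization.lean`), Theorem 4.4 = part I, Thm. 1.2 (tree: `BorceaBranden_realStabilityPreserver_iff'`)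
and Theorem 3.2 for `H_{π/2}` (tree: `BorceaBranden_rightHalfPlaneStabilityPreserver_iff`). The operator `T` is the
tree's `mvMultiplierOp λ`; its symbols are `realBoundedDegreeSymbol κ T = T[(z+w)^κ]`,
`realBoundedDegreeSymbolNeg κ T = T[(z-w)^κ]` (real) and `boundedDegreeSymbolD κ T = T[(1+zw)^κ]` (Hurwitz); the box
polynomial `binomTwist κ s λ = Σ_{α ≤ κ} s^α binom(κ,α) λ(α) t^α` (`s = ±1`) is the polynomial whose diagonal image
`diagSubst` is the printed `Σ (±1)^α binom(κ,α) λ(α) z^α w^α`. Condition (b)/(d) is written in the form used in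
§8.5 (uik) and in `WagnerTheorem.lean`: `λ(α) = C Π_i u_i(α_i)` on the box with the Jensen polynomials
`Σ_k binom(κ_i,k) u_i(k) t^k` (`binomialForm`) having only real zeros of one sign.

* §1 `IsMultiplierSeq`, `binomTwist`, `coeff_binomTwist`, `eval_binomTwist`.
* §2 The symbols of a diagonal operator as diagonal images: `boundedDegreeSymbolD_mvMultiplierOp`
  (`T[(1+zw)^κ] = diagSubst (binomTwist κ 1 λ)`), `eval_mvMultiplierOp_symbol_eq` (`T[(z+w)^κ] = w^κ f(z,-1/w)`),
  `isRealStable_symbol_mvMultiplierOp_iff`, `isRealStable_symbolNeg_mvMultiplierOp_iff`,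
  `isHThetaStable_diagSubst_binomTwist_iff` (the rotation "which occurs exactly when … is stable").
* §3 Coefficients of products `C Π_l f_l(t_l)` and **`isUpperHalfPlaneStable_diagSubst_binomTwist_iff`**: Lemma 4.3 for
  the box polynomial, translated into the product form of `λ`.
* §4 **Theorem 4.5**: `isMultiplierSeq_of_symbol` ((c) ⇒ (a)), `isRealStable_symbol_iff_prod` and
  `isRealStable_symbolNeg_iff_prod` ((c) ⇔ (b)/(d), for each of the two symbols), `realStable_symbol_or_neg_of_isMultiplierSeq`
  ((a) ⇒ (c) for sequences with at least three nonzero terms on the box), `BorceaBranden_hardPolyaSchur` (the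
  equivalences for such sequences), and `stable_or_zero_of_isRealStable_symbol` (Remark 4.1, the direction given by
  Theorem 3.1).
* §5 **Corollary 4.6** `BorceaBranden_weaklyHurwitzMultiplier_iff` (both directions; the multiple `0` of the printed
  statement appears as the alternative `λ ≡ 0` on the box) and `exists_prod_of_weaklyHurwitzStabilityPreserver` (the
  necessity half in the form (uik) of §8.5, cf. the `TODO(general form)` in `WagnerTheorem.lean`).

On the degenerate range of Theorem 4.5: the zero sequence is a `κ`-multiplier sequence in the sense above (its
operator maps everything to `0`) although `T[(z±w)^κ] = 0 ∉ 𝓗_{2n}(ℝ)`; the implication (a) ⇒ (c) is therefore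
proved here under the hypothesis that `λ` has at least three nonzero terms on the box, which rules out the
rank-`≤ 2` alternative (a) of Theorem 4.4.
-- TODO(general form): Theorem 4.5 (a) ⇒ (c) for nonzero sequences with at most two nonzero terms on the box.

## References

* [BorceaBranden2009II] J. Borcea, P. Brändén, Comm. Pure Appl. Math. 62 (2009) 1595–1631, §4 Thm. 4.5, Remark 4.1,
  Cor. 4.6, Lemma 4.3, Thm. 4.4; §3 Thms. 3.1, 3.2; §8.5 (uik).
* [BorceaBranden2009] J. Borcea, P. Brändén, Invent. Math. 177 (2009), Thms. 1.1, 1.2.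
-/

noncomputable section

open MvPolynomial Finset

namespace Literature.Combinatorics.StablePolynomials

variable {τ : Type*}

/-! ## §1 `κ`-multiplier sequences and the box polynomials `Σ_{α ≤ κ} s^α binom(κ,α) λ(α) t^α` -/

section Defs

variable [Fintype τ] [DecidableEq τ]

/-- **`κ`-multiplier sequence** ("a sequence `{λ(α)}_{α ≤ κ}` of real numbers is a `κ`-multiplier sequence if the
linear operator `T : ℝ_κ[z_1,…,z_n] → ℝ_κ[z_1,…,z_n]` defined by `T(z^α) = λ(α)z^α`, `α ≤ κ`, preserves real
stability"); here `T = mvMultiplierOp λ` and "preserves real stability" is, as everywhere in the tree, "maps real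
stable polynomials of `ℝ_κ[z]` to real stable polynomials or to `0`".
[cite: BorceaBranden2009II, §4 (definition of `κ`-multiplier sequences)] -/
def IsMultiplierSeq (κ : τ → ℕ) (lam : (τ →₀ ℕ) → ℝ) : Prop :=
  ∀ p : MvPolynomial τ ℝ, (∀ i, degreeOf i p ≤ κ i) → IsRealStable p →
    IsRealStable (mvMultiplierOp lam p) ∨ mvMultiplierOp lam p = 0

/-- **The box polynomial `Σ_{α ≤ κ} s^{|α|} binom(κ,α) b(α) t^α ∈ ℂ[t_τ]`** (`s = -1`: the polynomial whose
diagonal image is "`Σ_{α≤κ} (-1)^α binom(κ,α) λ(α) z^α w^α`"; `s = 1`: `T[(1+zw)^κ]`).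
[cite: BorceaBranden2009II, §4 proof of Cor. 4.6 ("`Σ_{α ≤ κ} (-1)^α binom(κ,α) λ(α) z^α w^α`")] -/
def binomTwist (κ : τ → ℕ) (s : ℂ) (b : (τ →₀ ℕ) → ℂ) : MvPolynomial τ ℂ :=
  ∑ m ∈ Fintype.piFinset (fun i => range (κ i + 1)),
    monomial (toF m) (s ^ (∑ i, m i) * (∏ i, (((κ i).choose (m i) : ℕ) : ℂ)) * b (toF m))

/-- The coefficients of the box polynomial. [cite: BorceaBranden2009II, §4 proof of Cor. 4.6] -/
theorem coeff_binomTwist (κ : τ → ℕ) (s : ℂ) (b : (τ →₀ ℕ) → ℂ) (α : τ →₀ ℕ) :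
    coeff α (binomTwist κ s b) =
      if α ≤ toF κ then s ^ α.degree * (∏ i, (((κ i).choose (α i) : ℕ) : ℂ)) * b α else 0 := by
  rw [binomTwist, coeff_sum]
  simp_rw [coeff_monomial]
  have hinj : ∀ m : τ → ℕ, toF m = α → m = ⇑α := fun m h => funext fun i => by rw [← toF_apply m i, h]
  split_ifs with hα
  · have hmem : (⇑α : τ → ℕ) ∈ Fintype.piFinset (fun i => range (κ i + 1)) :=
      mem_box_iff.2 fun i => by have := Finsupp.le_def.1 hα i; rwa [toF_apply] at this
    rw [sum_eq_single (⇑α : τ → ℕ) (fun m _ hm => if_neg fun h => hm (hinj m h))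
      (fun h => absurd hmem h), if_pos (toF_coe α), toF_coe, Finsupp.degree_eq_sum]
  · refine sum_eq_zero fun m hm => if_neg fun h => hα ?_
    rw [← h]
    exact Finsupp.le_def.2 fun i => by rw [toF_apply, toF_apply]; exact mem_box_iff.1 hm i

/-- `deg_{t_i}` of the box polynomial is `≤ κ_i`. [cite: BorceaBranden2009II, §4 (the space `ℂ_κ[z]`)] -/
theorem degreeOf_binomTwist_le (κ : τ → ℕ) (s : ℂ) (b : (τ →₀ ℕ) → ℂ) (i : τ) :
    degreeOf i (binomTwist κ s b) ≤ κ i := by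
  rw [degreeOf_le_iff]
  intro m hm
  have h := mem_support_iff.1 hm
  rw [coeff_binomTwist] at h
  split_ifs at h with hle
  · have := Finsupp.le_def.1 hle i
    rwa [toF_apply] at this
  · exact absurd rfl h

/-- `Σ s^α c_α x^α = Σ c_α (s x)^α`: evaluating the box polynomial. [cite: BorceaBranden2009II, §4 proof of
Cor. 4.6] -/
theorem eval_binomTwist (κ : τ → ℕ) (s : ℂ) (b : (τ →₀ ℕ) → ℂ) (x : τ → ℂ) :
    eval x (binomTwist κ s b) = eval (fun i => s * x i) (binomTwist κ 1 b) := by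
  rw [binomTwist, binomTwist, map_sum, map_sum]
  refine sum_congr rfl fun m _ => ?_
  rw [eval_monomial, eval_monomial, one_pow, one_mul, Finsupp.prod_fintype _ _ (fun i => pow_zero _),
    Finsupp.prod_fintype _ _ (fun i => pow_zero _)]
  simp only [toF_apply, mul_pow, prod_mul_distrib, prod_pow_eq_pow_sum]
  ring

end Defs

/-! ## §2 The symbols of a diagonal operator as diagonal polynomials -/

section Symbols

variable [Fintype τ] [DecidableEq τ]

/-- **`T[(1+zw)^κ] = Σ_{α ≤ κ} binom(κ,α) b(α) z^α w^α`** for `T = mvMultiplierOp b`: the symbol of Theorem 3.2 is the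
diagonal image of the box polynomial (`s = 1`). [cite: BorceaBranden2009II, §4 proof of Cor. 4.6
("`T[(z+w)^κ] = Σ_{α ≤ κ} binom(κ,α) λ(α) z^α w^{κ-α}`"), §3 Thm 3.2] -/
theorem boundedDegreeSymbolD_mvMultiplierOp (κ : τ → ℕ) (b : (τ →₀ ℕ) → ℂ) :
    boundedDegreeSymbolD κ (mvMultiplierOp b) = diagSubst (binomTwist κ 1 b) := by
  rw [boundedDegreeSymbolD, binomTwist, map_sum]
  refine sum_congr rfl fun m _ => ?_
  rw [mvMultiplierOp_prod_X_pow, map_smul, _root_.map_prod, one_pow, one_mul, diagSubst_monomial,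
    monomial_pairExp, smul_mul_assoc, smul_smul, smul_eq_C_mul]
  simp only [map_pow, rename_X, toF_apply]

/-- **`T[Π_i(z_i+w_i)^{κ_i}](z) = w^κ · f(z,-w^{-1})`** with `f` the diagonal image of the box polynomial with
`s = -1`, for `w_i ≠ 0`. [cite: BorceaBranden2009II, §4 proof of Lemma 4.3 ("`G_T(z,w) = w^κ f(z,-w^{-1})`"),
proof of Cor. 4.6] -/
theorem eval_mvMultiplierOp_symbol_eq (κ : τ → ℕ) (b : (τ →₀ ℕ) → ℂ) (z w : τ → ℂ) (hw : ∀ i, w i ≠ 0) :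
    eval z (mvMultiplierOp b (∏ i, (X i + C (w i)) ^ κ i)) =
      (∏ i, w i ^ κ i) * eval (Sum.elim z fun i => -(w i)⁻¹) (diagSubst (binomTwist κ (-1) b)) := by
  rw [eval_mvMultiplierOp_prod_X_add_C_pow, eval_diagSubst, binomTwist, map_sum, mul_sum]
  refine sum_congr rfl fun m hm => ?_
  rw [eval_monomial, Finsupp.prod_fintype _ _ (fun i => pow_zero _)]
  simp only [Sum.elim_inl, Sum.elim_inr, toF_apply]
  have hterm : ∀ i, w i ^ κ i * (z i * -(w i)⁻¹) ^ m i = (-1) ^ m i * (z i ^ m i * w i ^ (κ i - m i)) := by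
    intro i
    obtain ⟨e, he⟩ := Nat.exists_eq_add_of_le (mem_box_iff.1 hm i)
    rw [he, Nat.add_sub_cancel_left, pow_add, mul_pow, neg_pow, inv_pow]
    have hwi : w i ^ m i ≠ 0 := pow_ne_zero _ (hw i)
    field_simp
  have hsign : ((-1 : ℂ) ^ ∑ i, m i) * (-1) ^ ∑ i, m i = 1 := by
    rw [← pow_add, ← two_mul, pow_mul]; norm_num
  have hR : (∏ i, w i ^ κ i) * ∏ i, (z i * -(w i)⁻¹) ^ m i = (-1) ^ (∑ i, m i) * ∏ i, (z i ^ m i * w i ^ (κ i - m i)) := by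
    rw [← prod_mul_distrib, prod_congr rfl fun i _ => hterm i, prod_mul_distrib, prod_pow_eq_pow_sum]
  calc b (toF m) * ∏ i, (((κ i).choose (m i) : ℕ) : ℂ) * z i ^ m i * w i ^ (κ i - m i)
      = b (toF m) * (∏ i, (((κ i).choose (m i) : ℕ) : ℂ)) * ∏ i, (z i ^ m i * w i ^ (κ i - m i)) := by
        simp only [prod_mul_distrib]; ring
    _ = b (toF m) * (∏ i, (((κ i).choose (m i) : ℕ) : ℂ)) *
          ((((-1 : ℂ) ^ ∑ i, m i) * (-1) ^ ∑ i, m i) * ∏ i, (z i ^ m i * w i ^ (κ i - m i))) := by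
        rw [hsign, one_mul]
    _ = (-1) ^ (∑ i, m i) * (∏ i, (((κ i).choose (m i) : ℕ) : ℂ)) * b (toF m) *
          ((∏ i, w i ^ κ i) * ∏ i, (z i * -(w i)⁻¹) ^ m i) := by rw [hR]; ring
    _ = _ := by ring

/-- **`G_T = T[(z+w)^κ]` is stable iff `Σ_{α≤κ} (-1)^α binom(κ,α) b(α) z^α w^α` is stable** (`T = mvMultiplierOp b`;
the inversion `w ↦ -1/w` of `H`). [cite: BorceaBranden2009II, §4 proof of Lemma 4.3 and of Cor. 4.6] -/
theorem isUpperHalfPlaneStable_boundedDegreeSymbol_mvMultiplierOp_iff (κ : τ → ℕ) (b : (τ →₀ ℕ) → ℂ) :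
    IsUpperHalfPlaneStable (boundedDegreeSymbol κ (mvMultiplierOp b)) ↔
      IsUpperHalfPlaneStable (diagSubst (binomTwist κ (-1) b)) := by
  rw [isUpperHalfPlaneStable_boundedDegreeSymbol_iff]
  constructor
  · intro h Z hZ
    set w : τ → ℂ := fun i => -(Z (Sum.inr i))⁻¹ with hw
    have hwim : ∀ i, 0 < (w i).im := fun i => neg_inv_im_pos (hZ _)
    have hw0 : ∀ i, w i ≠ 0 := fun i h0 => by
      have := hwim i; rw [h0, Complex.zero_im] at this; exact lt_irrefl _ this
    have key := h (fun i => Z (Sum.inl i)) w (fun i => hZ _) hwim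
    rw [eval_mvMultiplierOp_symbol_eq κ b _ w hw0] at key
    have hback : (Sum.elim (fun i => Z (Sum.inl i)) fun i => -(w i)⁻¹) = Z := by
      ext x; rcases x with i | i
      · rfl
      · simp [hw]
    rw [hback] at key
    exact (mul_ne_zero_iff.1 key).2
  · intro h z w hz hw
    have hw0 : ∀ i, w i ≠ 0 := fun i h0 => by
      have := hw i; rw [h0, Complex.zero_im] at this; exact lt_irrefl _ this
    rw [eval_mvMultiplierOp_symbol_eq κ b z w hw0]
    refine mul_ne_zero (prod_ne_zero_iff.2 fun i _ => pow_ne_zero _ (hw0 i)) (h _ fun x => ?_)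
    rcases x with i | i
    · exact hz i
    · exact neg_inv_im_pos (hw i)

/-- **Real diagonal operators: `T[(z+w)^κ] ∈ 𝓗_{2n}(ℝ)` iff `Σ_{α≤κ} (-1)^α binom(κ,α) λ(α) z^α w^α` is stable.**
[cite: BorceaBranden2009II, §4 Thm. 4.5 (c), proof of Cor. 4.6] -/
theorem isRealStable_symbol_mvMultiplierOp_iff (κ : τ → ℕ) (lam : (τ →₀ ℕ) → ℝ) :
    IsRealStable (realBoundedDegreeSymbol κ (mvMultiplierOp lam)) ↔
      IsUpperHalfPlaneStable (diagSubst (binomTwist κ (-1) fun s => ((lam s : ℝ) : ℂ))) := by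
  rw [IsRealStable, map_realBoundedDegreeSymbol, complexify_mvMultiplierOp,
    isUpperHalfPlaneStable_boundedDegreeSymbol_mvMultiplierOp_iff]

/-- **Real diagonal operators: `T[(z-w)^κ] ∈ 𝓗_{2n}(ℝ)` iff `Σ_{α≤κ} binom(κ,α) λ(α) z^α w^α` is stable.**
[cite: BorceaBranden2009II, §4 Thm. 4.5 (c)] -/
theorem isRealStable_symbolNeg_mvMultiplierOp_iff (κ : τ → ℕ) (lam : (τ →₀ ℕ) → ℝ) :
    IsRealStable (realBoundedDegreeSymbolNeg κ (mvMultiplierOp lam)) ↔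
      IsUpperHalfPlaneStable (diagSubst (binomTwist κ 1 fun s => ((lam s : ℝ) : ℂ))) := by
  set b : (τ →₀ ℕ) → ℂ := fun s => ((lam s : ℝ) : ℂ) with hb
  have hev : ∀ z w : τ → ℂ, (∀ i, w i ≠ 0) →
      eval (Sum.elim z w) (map (algebraMap ℝ ℂ) (realBoundedDegreeSymbolNeg κ (mvMultiplierOp lam))) =
        (∏ i, (-w i) ^ κ i) * eval (Sum.elim z fun i => -(w i)⁻¹) (diagSubst (binomTwist κ 1 b)) := by
    intro z w hw0
    have hw0' : ∀ i, -w i ≠ 0 := fun i => neg_ne_zero.2 (hw0 i)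
    rw [eval_map_realBoundedDegreeSymbolNeg, complexify_mvMultiplierOp, ← hb,
      eval_mvMultiplierOp_symbol_eq κ b z (fun i => -w i) hw0', eval_diagSubst, eval_diagSubst, eval_binomTwist]
    have hfg : (fun i => (-1 : ℂ) * (Sum.elim z (fun i => -(-w i)⁻¹) (Sum.inl i) *
        Sum.elim z (fun i => -(-w i)⁻¹) (Sum.inr i))) =
        fun i => Sum.elim z (fun i => -(w i)⁻¹) (Sum.inl i) * Sum.elim z (fun i => -(w i)⁻¹) (Sum.inr i) := by
      funext i
      simp only [Sum.elim_inl, Sum.elim_inr]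
      ring
    rw [hfg]
  constructor
  · intro h Z hZ
    set w : τ → ℂ := fun i => -(Z (Sum.inr i))⁻¹ with hw
    have hwim : ∀ i, 0 < (w i).im := fun i => neg_inv_im_pos (hZ _)
    have hw0 : ∀ i, w i ≠ 0 := fun i h0 => by
      have := hwim i; rw [h0, Complex.zero_im] at this; exact lt_irrefl _ this
    have key := h (Sum.elim (fun i => Z (Sum.inl i)) w) (fun x => by
      rcases x with i | i
      · exact hZ _
      · exact hwim i)
    rw [hev _ w hw0] at key
    have hback : (Sum.elim (fun i => Z (Sum.inl i)) fun i => -(w i)⁻¹) = Z := by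
      ext x; rcases x with i | i
      · rfl
      · simp [hw]
    rw [hback] at key
    exact (mul_ne_zero_iff.1 key).2
  · intro h Z hZ
    have hZ0 : ∀ i, (Z ∘ Sum.inr) i ≠ 0 := fun i h0 => by
      have := hZ (Sum.inr i); rw [Function.comp_apply] at h0; rw [h0, Complex.zero_im] at this
      exact lt_irrefl _ this
    rw [← Sum.elim_comp_inl_inr Z, hev _ _ hZ0]
    refine mul_ne_zero (prod_ne_zero_iff.2 fun i _ => pow_ne_zero _ (neg_ne_zero.2 (hZ0 i))) (h _ fun x => ?_)
    rcases x with i | i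
    · exact hZ _
    · exact neg_inv_im_pos (hZ _)

/-- **Weak Hurwitz stability of `T[(1+zw)^κ]` iff stability of `Σ_{α≤κ} (-1)^α binom(κ,α) b(α) z^α w^α`** (the
rotation `z ↦ -iz`). [cite: BorceaBranden2009II, §4 proof of Cor. 4.6 ("is weakly Hurwitz stable, which occurs
exactly when `Σ_{α ≤ κ} (-1)^α binom(κ,α) λ(α) z^α w^α` is stable")] -/
theorem isHThetaStable_diagSubst_binomTwist_iff (κ : τ → ℕ) (b : (τ →₀ ℕ) → ℂ) :
    IsHThetaStable (Real.pi / 2) (diagSubst (binomTwist κ 1 b)) ↔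
      IsUpperHalfPlaneStable (diagSubst (binomTwist κ (-1) b)) := by
  rw [isHThetaStable_pi_div_two_iff]
  constructor
  · intro h Z hZ
    have key := h (fun x => -Complex.I * Z x) (fun x => by simpa using hZ x)
    rw [eval_diagSubst] at key
    rw [eval_diagSubst, eval_binomTwist]
    have hfg : (fun i => (-1 : ℂ) * (Z (Sum.inl i) * Z (Sum.inr i))) =
        fun i => -Complex.I * Z (Sum.inl i) * (-Complex.I * Z (Sum.inr i)) :=
      funext fun i => by linear_combination (-(Z (Sum.inl i) * Z (Sum.inr i))) * Complex.I_sq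
    rw [hfg]
    exact key
  · intro h Z hZ
    have key := h (fun x => Complex.I * Z x) (fun x => by simpa using hZ x)
    rw [eval_diagSubst, eval_binomTwist] at key
    rw [eval_diagSubst]
    have hfg : (fun i => Z (Sum.inl i) * Z (Sum.inr i)) =
        fun i => (-1 : ℂ) * (Complex.I * Z (Sum.inl i) * (Complex.I * Z (Sum.inr i))) :=
      funext fun i => by linear_combination (Z (Sum.inl i) * Z (Sum.inr i)) * Complex.I_sq
    rw [hfg]
    exact key

end Symbols

/-! ## §3 Products of univariate polynomials in distinct variables -/

section ProductForm

variable [Fintype τ] [DecidableEq τ]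

/-- `Π_l f_l(t_l)` expanded over the box of degrees. [cite: BorceaBranden2009II, §4 Lemma 4.3 ("`f_1(z_1w_1)⋯f_n(z_nw_n)`")] -/
theorem prod_aeval_X_eq_sum (f : τ → Polynomial ℝ) :
    (∏ l, Polynomial.aeval (X l : MvPolynomial τ ℂ) (f l)) =
      ∑ m ∈ Fintype.piFinset (fun l => range ((f l).natDegree + 1)),
        monomial (toF m) (∏ l, (((f l).coeff (m l) : ℝ) : ℂ)) := by
  have h : ∀ l, Polynomial.aeval (X l : MvPolynomial τ ℂ) (f l) =
      ∑ k ∈ range ((f l).natDegree + 1), C (((f l).coeff k : ℝ) : ℂ) * X l ^ k := by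
    intro l
    rw [Polynomial.aeval_eq_sum_range]
    refine sum_congr rfl fun k _ => ?_
    rw [Algebra.smul_def, MvPolynomial.algebraMap_apply, Complex.coe_algebraMap]
  simp_rw [h]
  rw [prod_univ_sum]
  refine sum_congr rfl fun m _ => ?_
  rw [prod_mul_distrib, prod_X_pow_eq_monomial_toF, ← _root_.map_prod C, C_mul_monomial, mul_one]

/-- **The coefficients of `C · Π_l f_l(t_l)`**: `[t^α] = C Π_l [t^{α_l}] f_l`.
[cite: BorceaBranden2009II, §4 Lemma 4.3 ("`f(z,w) = C f_1(z_1w_1)⋯f_n(z_nw_n)`")] -/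
theorem coeff_C_mul_prod_aeval (c : ℂ) (f : τ → Polynomial ℝ) (α : τ →₀ ℕ) :
    coeff α (C c * ∏ l, Polynomial.aeval (X l : MvPolynomial τ ℂ) (f l)) =
      c * ∏ l, (((f l).coeff (α l) : ℝ) : ℂ) := by
  rw [coeff_C_mul, prod_aeval_X_eq_sum, coeff_sum]
  simp_rw [coeff_monomial]
  have hinj : ∀ m : τ → ℕ, toF m = α → m = ⇑α := fun m h => funext fun i => by rw [← toF_apply m i, h]
  congr 1
  by_cases hα : (⇑α : τ → ℕ) ∈ Fintype.piFinset (fun l => range ((f l).natDegree + 1))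
  · rw [sum_eq_single (⇑α : τ → ℕ) (fun m _ hm => if_neg fun h => hm (hinj m h)) (fun h => absurd hα h),
      if_pos (toF_coe α)]
  · rw [sum_eq_zero fun m hm => if_neg fun h => hα (by rw [← hinj m h]; exact hm)]
    obtain ⟨l, hl⟩ : ∃ l, (f l).natDegree < α l := by
      by_contra hcon
      push Not at hcon
      exact hα (Fintype.mem_piFinset.2 fun l => mem_range.2 (Nat.lt_succ_of_le (hcon l)))
    rw [prod_eq_zero (mem_univ l) (by rw [Polynomial.coeff_eq_zero_of_natDegree_lt hl]; simp)]

/-- In a factorisation `p = C Π_l f_l(t_l)` (`C ≠ 0`, all `f_l ≠ 0`) of `p ∈ ℂ_κ[t]`, `deg f_l ≤ κ_l`.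
[cite: BorceaBranden2009II, §4 Lemma 4.3, Thm. 4.5 (d)] -/
theorem natDegree_le_of_eq_C_mul_prod {p : MvPolynomial τ ℂ} {κ : τ → ℕ} (hp : ∀ l, degreeOf l p ≤ κ l) {c : ℂ}
    (hc : c ≠ 0) {f : τ → Polynomial ℝ} (hf : ∀ l, f l ≠ 0)
    (h : p = C c * ∏ l, Polynomial.aeval (X l : MvPolynomial τ ℂ) (f l)) (l : τ) : (f l).natDegree ≤ κ l := by
  set α : τ →₀ ℕ := toF fun l' => (f l').natDegree with hα
  have hcoeff : coeff α p ≠ 0 := by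
    rw [h, coeff_C_mul_prod_aeval]
    refine mul_ne_zero hc (prod_ne_zero_iff.2 fun l' _ => ?_)
    rw [hα, toF_apply]
    have h0 := Polynomial.leadingCoeff_ne_zero.2 (hf l')
    rw [Polynomial.leadingCoeff] at h0
    exact_mod_cast h0
  have := monomial_le_degreeOf l (mem_support_iff.2 hcoeff)
  rw [hα, toF_apply] at this
  exact this.trans (hp l)

/-- A polynomial with the zero set condition of Lemma 4.3 is nonzero. [cite: BorceaBranden2009II, §4 Lemma 4.3] -/
theorem ne_zero_of_roots {q : Polynomial ℝ} {P : ℂ → Prop} (hP : ¬ P Complex.I)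
    (h : ∀ t : ℂ, Polynomial.aeval t q = 0 → P t) : q ≠ 0 := by
  rintro rfl
  exact hP (h _ (by simp))

/-- **The product form of a box sequence.** For `s = ±1`, the diagonal image of
`Σ_{α ≤ κ} s^α binom(κ,α) b(α) t^α` is stable iff `b(α) = C Π_i u_i(α_i)` on the box (`C ≠ 0`) with every Jensen
polynomial `Σ_{k ≤ κ_i} binom(κ_i,k) u_i(k) t^k` having only real zeros `t` with `s t ≥ 0`. (Lemma 4.3 applied to
the box polynomial; `u_i(k) = s^k [t^k]f_i / binom(κ_i,k)`.) [cite: BorceaBranden2009II, §4 Thm. 4.5 ((c) ⇔ (d) ⇔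
(b)), Cor. 4.6, Lemma 4.3] -/
theorem isUpperHalfPlaneStable_diagSubst_binomTwist_iff (κ : τ → ℕ) {s : ℝ} (hs : s = 1 ∨ s = -1)
    (b : (τ →₀ ℕ) → ℂ) :
    IsUpperHalfPlaneStable (diagSubst (binomTwist κ (s : ℂ) b)) ↔
      ∃ (c : ℂ) (u : τ → ℕ → ℝ), c ≠ 0 ∧
        (∀ i (t : ℂ), (binomialForm (κ i) fun k => ((u i k : ℝ) : ℂ)).eval t = 0 →
          t.im = 0 ∧ 0 ≤ s * t.re) ∧
        ∀ α : τ →₀ ℕ, α ≤ toF κ → b α = c * ∏ i, ((u i (α i) : ℝ) : ℂ) := by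
  have hs2 : s * s = 1 := by rcases hs with rfl | rfl <;> norm_num
  have hs0 : s ≠ 0 := fun h => by rw [h, mul_zero] at hs2; exact zero_ne_one hs2
  have hspow : ∀ k : ℕ, (s : ℂ) ^ k * (s : ℂ) ^ k = 1 := fun k => by
    rw [← mul_pow, ← Complex.ofReal_mul, hs2, Complex.ofReal_one, one_pow]
  rw [isUpperHalfPlaneStable_diagSubst_iff]
  constructor
  · rintro ⟨c, f, hc, hf, hg⟩
    have hf0 : ∀ l, f l ≠ 0 := fun l => ne_zero_of_roots (P := fun t => t.im = 0 ∧ 0 ≤ t.re) (by simp) (hf l)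
    have hdeg : ∀ l, (f l).natDegree ≤ κ l :=
      natDegree_le_of_eq_C_mul_prod (degreeOf_binomTwist_le κ _ b) hc hf0 hg
    refine ⟨c, fun l k => s ^ k * (f l).coeff k / ((κ l).choose k : ℝ), hc, fun l t ht => ?_, fun α hα => ?_⟩
    · -- the Jensen polynomial of `u_l` is `f_l(s t)`
      have hJ : (binomialForm (κ l) fun k => (((s ^ k * (f l).coeff k / ((κ l).choose k : ℝ)) : ℝ) : ℂ)).eval t =
          Polynomial.aeval ((s : ℂ) * t) (f l) := by
        rw [eval_binomialForm, Polynomial.aeval_eq_sum_range' (Nat.lt_succ_of_le (hdeg l))]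
        refine sum_congr rfl fun k hk => ?_
        have hk' : k ≤ κ l := Nat.lt_succ_iff.1 (mem_range.1 hk)
        have hb0 : (((κ l).choose k : ℕ) : ℂ) ≠ 0 := Nat.cast_ne_zero.2 (Nat.choose_pos hk').ne'
        rw [Algebra.smul_def, Complex.coe_algebraMap, mul_pow]
        push_cast
        field_simp
      rw [hJ] at ht
      obtain ⟨him, hre⟩ := hf l _ ht
      rw [Complex.mul_im, Complex.ofReal_re, Complex.ofReal_im, zero_mul, add_zero] at him
      rw [Complex.mul_re, Complex.ofReal_re, Complex.ofReal_im, zero_mul, sub_zero] at hre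
      exact ⟨(mul_eq_zero.1 him).resolve_left hs0, hre⟩
    · -- compare coefficients at `α ≤ κ`
      have h1 := coeff_binomTwist κ (s : ℂ) b α
      rw [if_pos hα, hg, coeff_C_mul_prod_aeval] at h1
      have hb : (∏ i, (((κ i).choose (α i) : ℕ) : ℂ)) ≠ 0 :=
        prod_ne_zero_iff.2 fun i _ => Nat.cast_ne_zero.2 (Nat.choose_pos (by
          have := Finsupp.le_def.1 hα i; rwa [toF_apply] at this)).ne'
      have hsd : (s : ℂ) ^ α.degree * (s : ℂ) ^ α.degree = 1 := hspow _
      calc b α = ((s : ℂ) ^ α.degree * (s : ℂ) ^ α.degree) *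
            ((∏ i, (((κ i).choose (α i) : ℕ) : ℂ))⁻¹ * ∏ i, (((κ i).choose (α i) : ℕ) : ℂ)) * b α := by
              rw [hsd, inv_mul_cancel₀ hb, one_mul, one_mul]
        _ = (s : ℂ) ^ α.degree * (∏ i, (((κ i).choose (α i) : ℕ) : ℂ))⁻¹ *
              ((s : ℂ) ^ α.degree * (∏ i, (((κ i).choose (α i) : ℕ) : ℂ)) * b α) := by ring
        _ = (s : ℂ) ^ α.degree * (∏ i, (((κ i).choose (α i) : ℕ) : ℂ))⁻¹ *
              (c * ∏ l, (((f l).coeff (α l) : ℝ) : ℂ)) := by rw [h1]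
        _ = c * ((s : ℂ) ^ α.degree * (∏ i, (((κ i).choose (α i) : ℕ) : ℂ))⁻¹ *
              ∏ l, (((f l).coeff (α l) : ℝ) : ℂ)) := by ring
        _ = _ := by
          rw [Finsupp.degree_eq_sum, ← prod_pow_eq_pow_sum, ← prod_inv_distrib, ← prod_mul_distrib,
            ← prod_mul_distrib]
          congr 1
          refine prod_congr rfl fun i _ => ?_
          push_cast
          ring
  · rintro ⟨c, u, hc, hu, hb⟩
    -- `f_l(t) = J_l(s t)` has its zeros in `[0,∞)`
    refine ⟨c, fun l => ∑ k ∈ range (κ l + 1),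
      Polynomial.monomial k (s ^ k * ((κ l).choose k : ℝ) * u l k), hc, fun l t ht => ?_, ?_⟩
    · have hJ : Polynomial.aeval t (∑ k ∈ range (κ l + 1),
          Polynomial.monomial k (s ^ k * ((κ l).choose k : ℝ) * u l k)) =
          (binomialForm (κ l) fun k => ((u l k : ℝ) : ℂ)).eval ((s : ℂ) * t) := by
        rw [map_sum, eval_binomialForm]
        refine sum_congr rfl fun k _ => ?_
        rw [Polynomial.aeval_monomial, Complex.coe_algebraMap]
        push_cast
        ring
      rw [hJ] at ht
      obtain ⟨him, hre⟩ := hu l _ ht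
      rw [Complex.mul_im, Complex.ofReal_re, Complex.ofReal_im, zero_mul, add_zero] at him
      rw [Complex.mul_re, Complex.ofReal_re, Complex.ofReal_im, zero_mul, sub_zero, ← mul_assoc, hs2,
        one_mul] at hre
      exact ⟨(mul_eq_zero.1 him).resolve_left hs0, hre⟩
    · refine MvPolynomial.ext _ _ fun α => ?_
      rw [coeff_binomTwist, coeff_C_mul_prod_aeval]
      have hcoef : ∀ l k, (∑ k ∈ range (κ l + 1),
          Polynomial.monomial k (s ^ k * ((κ l).choose k : ℝ) * u l k)).coeff k =
            if k ≤ κ l then s ^ k * ((κ l).choose k : ℝ) * u l k else 0 := by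
        intro l k
        rw [Polynomial.finsetSum_coeff]
        simp_rw [Polynomial.coeff_monomial]
        split_ifs with hk
        · rw [sum_eq_single k (fun j _ hj => if_neg hj) (fun h => absurd (mem_range.2 (Nat.lt_succ_of_le hk)) h),
            if_pos rfl]
        · exact sum_eq_zero fun j hj => if_neg fun h => hk (by rw [← h]; exact Nat.lt_succ_iff.1 (mem_range.1 hj))
      simp_rw [hcoef]
      split_ifs with hα
      · rw [hb α hα, Finsupp.degree_eq_sum, ← prod_pow_eq_pow_sum]
        rw [prod_congr rfl fun i _ => show (((if α i ≤ κ i then s ^ α i * ((κ i).choose (α i) : ℝ) * u i (α i)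
            else 0 : ℝ)) : ℂ) = (s : ℂ) ^ α i * (((κ i).choose (α i) : ℕ) : ℂ) * ((u i (α i) : ℝ) : ℂ) from by
          rw [if_pos (by have := Finsupp.le_def.1 hα i; rwa [toF_apply] at this)]; push_cast; ring]
        rw [prod_mul_distrib, prod_mul_distrib]
        ring
      · obtain ⟨l, hl⟩ : ∃ l, κ l < α l := by
          by_contra hcon
          push Not at hcon
          exact hα (Finsupp.le_def.2 fun l => by rw [toF_apply]; exact hcon l)
        rw [prod_eq_zero (mem_univ l) (by rw [if_neg (not_le.2 hl)]; simp), mul_zero]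

end ProductForm

/-! ## §4 Theorem 4.5 -/

section Theorem45

variable [Fintype τ] [DecidableEq τ]

/-- **Theorem 4.5, (c) ⇒ (a)**: if `T[(z+w)^κ] ∈ 𝓗_{2n}(ℝ)` or `T[(z-w)^κ] ∈ 𝓗_{2n}(ℝ)` then `λ` is a
`κ`-multiplier sequence (Theorem 4.4 = part I, Thm. 1.2). [cite: BorceaBranden2009II, §4 Thm. 4.5, Thm. 4.4] -/
theorem isMultiplierSeq_of_symbol {κ : τ → ℕ} {lam : (τ →₀ ℕ) → ℝ}
    (h : IsRealStable (realBoundedDegreeSymbol κ (mvMultiplierOp lam)) ∨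
      IsRealStable (realBoundedDegreeSymbolNeg κ (mvMultiplierOp lam))) : IsMultiplierSeq κ lam :=
  (BorceaBranden_realStabilityPreserver_iff' κ (mvMultiplierOp lam)).2 (Or.inr h)

/-- **Theorem 4.5, (c) ⇔ (d)/(b) for `T[(z+w)^κ]`**: `T[(z+w)^κ] ∈ 𝓗_{2n}(ℝ)` iff `λ(α) = C Π_i λ_i(α_i)` on the box
with `C ≠ 0` and every `Σ_{k ≤ κ_i} binom(κ_i,k) λ_i(k) t^k` having only real zeros `≤ 0` ("non-negative"
one-dimensional `κ_i`-multiplier sequences). [cite: BorceaBranden2009II, §4 Thm. 4.5 ((b), (c), (d))] -/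
theorem isRealStable_symbol_iff_prod (κ : τ → ℕ) (lam : (τ →₀ ℕ) → ℝ) :
    IsRealStable (realBoundedDegreeSymbol κ (mvMultiplierOp lam)) ↔
      ∃ (c : ℝ) (u : τ → ℕ → ℝ), c ≠ 0 ∧
        (∀ i (t : ℂ), (binomialForm (κ i) fun k => ((u i k : ℝ) : ℂ)).eval t = 0 → t.im = 0 ∧ t.re ≤ 0) ∧
        ∀ α : τ →₀ ℕ, α ≤ toF κ → lam α = c * ∏ i, u i (α i) := by
  rw [isRealStable_symbol_mvMultiplierOp_iff,
    show ((-1 : ℂ)) = ((-1 : ℝ) : ℂ) by norm_num,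
    isUpperHalfPlaneStable_diagSubst_binomTwist_iff κ (Or.inr rfl)]
  constructor
  · rintro ⟨c, u, hc, hu, hb⟩
    -- `c` is real: pick `α` on the box with `λ(α) ≠ 0`? It may not exist; instead replace `c` by its real part
    -- when some product is nonzero, and handle the degenerate case `λ ≡ 0` on the box separately.
    by_cases hex : ∃ α : τ →₀ ℕ, α ≤ toF κ ∧ lam α ≠ 0
    · obtain ⟨α₀, hα₀, hne⟩ := hex
      set r : ℝ := ∏ i, u i (α₀ i) with hr
      have hrC : (∏ i, ((u i (α₀ i) : ℝ) : ℂ)) = (r : ℂ) := by rw [hr, Complex.ofReal_prod]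
      have e₀ := hb α₀ hα₀
      rw [hrC] at e₀
      have hr0 : (r : ℂ) ≠ 0 := fun h0 => hne (by rw [h0, mul_zero] at e₀; exact_mod_cast e₀)
      have hcreal : c = ((lam α₀ / r : ℝ) : ℂ) := by
        rw [Complex.ofReal_div, eq_div_iff hr0]
        exact e₀.symm
      refine ⟨lam α₀ / r, u, fun h0 => hc (by rw [hcreal, h0, Complex.ofReal_zero]),
        fun i t ht => ?_, fun α hα => ?_⟩
      · have := hu i t ht; simpa using this
      · have := hb α hα
        rw [hcreal, ← Complex.ofReal_prod, ← Complex.ofReal_mul] at this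
        exact_mod_cast this
    · -- degenerate: `λ ≡ 0` on the box; then every product `Π u_l(α_l)` vanishes, so some `u_l` vanishes on
      -- `[0, κ_l]` and its Jensen polynomial `J_l ≡ 0` has the non-real zero `i` — contradiction.
      push Not at hex
      exfalso
      have hall : ∃ l, ∀ k, k ≤ κ l → u l k = 0 := by
        by_contra hcon
        push Not at hcon
        choose k hk hk0 using hcon
        have hα : toF k ≤ toF κ := Finsupp.le_def.2 fun l => by rw [toF_apply, toF_apply]; exact hk l
        have := hb (toF k) hα
        rw [hex _ hα, Complex.ofReal_zero] at this
        exact hc ((mul_eq_zero.1 this.symm).resolve_right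
          (prod_ne_zero_iff.2 fun l _ => by rw [toF_apply]; exact_mod_cast hk0 l))
      obtain ⟨l, hl⟩ := hall
      have hJ : (binomialForm (κ l) fun k => ((u l k : ℝ) : ℂ)).eval Complex.I = 0 := by
        rw [eval_binomialForm]
        exact sum_eq_zero fun k hk => by
          rw [hl k (Nat.lt_succ_iff.1 (mem_range.1 hk)), Complex.ofReal_zero, mul_zero, zero_mul]
      have := (hu l _ hJ).1
      simp at this
  · rintro ⟨c, u, hc, hu, hb⟩
    refine ⟨(c : ℂ), u, by exact_mod_cast hc, fun i t ht => ?_, fun α hα => ?_⟩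
    · have := hu i t ht
      simpa using this
    · rw [hb α hα, Complex.ofReal_mul, Complex.ofReal_prod]

/-- **Theorem 4.5, (c) ⇔ (d)/(b) for `T[(z-w)^κ]`**: `T[(z-w)^κ] ∈ 𝓗_{2n}(ℝ)` iff `λ(α) = C Π_i λ_i(α_i)` on the box
with `C ≠ 0` and every `Σ_{k ≤ κ_i} binom(κ_i,k) λ_i(k) t^k` having only real zeros `≥ 0` ("alternating"
one-dimensional `κ_i`-multiplier sequences). [cite: BorceaBranden2009II, §4 Thm. 4.5 ((b), (c), (d))] -/
theorem isRealStable_symbolNeg_iff_prod (κ : τ → ℕ) (lam : (τ →₀ ℕ) → ℝ) :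
    IsRealStable (realBoundedDegreeSymbolNeg κ (mvMultiplierOp lam)) ↔
      ∃ (c : ℝ) (u : τ → ℕ → ℝ), c ≠ 0 ∧
        (∀ i (t : ℂ), (binomialForm (κ i) fun k => ((u i k : ℝ) : ℂ)).eval t = 0 → t.im = 0 ∧ 0 ≤ t.re) ∧
        ∀ α : τ →₀ ℕ, α ≤ toF κ → lam α = c * ∏ i, u i (α i) := by
  rw [isRealStable_symbolNeg_mvMultiplierOp_iff,
    show ((1 : ℂ)) = ((1 : ℝ) : ℂ) by norm_num,
    isUpperHalfPlaneStable_diagSubst_binomTwist_iff κ (Or.inl rfl)]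
  constructor
  · rintro ⟨c, u, hc, hu, hb⟩
    by_cases hex : ∃ α : τ →₀ ℕ, α ≤ toF κ ∧ lam α ≠ 0
    · obtain ⟨α₀, hα₀, hne⟩ := hex
      set r : ℝ := ∏ i, u i (α₀ i) with hr
      have hrC : (∏ i, ((u i (α₀ i) : ℝ) : ℂ)) = (r : ℂ) := by rw [hr, Complex.ofReal_prod]
      have e₀ := hb α₀ hα₀
      rw [hrC] at e₀
      have hr0 : (r : ℂ) ≠ 0 := fun h0 => hne (by rw [h0, mul_zero] at e₀; exact_mod_cast e₀)
      have hcreal : c = ((lam α₀ / r : ℝ) : ℂ) := by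
        rw [Complex.ofReal_div, eq_div_iff hr0]
        exact e₀.symm
      refine ⟨lam α₀ / r, u, fun h0 => hc (by rw [hcreal, h0, Complex.ofReal_zero]),
        fun i t ht => ?_, fun α hα => ?_⟩
      · have := hu i t ht; simpa using this
      · have := hb α hα
        rw [hcreal, ← Complex.ofReal_prod, ← Complex.ofReal_mul] at this
        exact_mod_cast this
    · push Not at hex
      exfalso
      have hall : ∃ l, ∀ k, k ≤ κ l → u l k = 0 := by
        by_contra hcon
        push Not at hcon
        choose k hk hk0 using hcon
        have hα : toF k ≤ toF κ := Finsupp.le_def.2 fun l => by rw [toF_apply, toF_apply]; exact hk l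
        have := hb (toF k) hα
        rw [hex _ hα, Complex.ofReal_zero] at this
        exact hc ((mul_eq_zero.1 this.symm).resolve_right
          (prod_ne_zero_iff.2 fun l _ => by rw [toF_apply]; exact_mod_cast hk0 l))
      obtain ⟨l, hl⟩ := hall
      have hJ : (binomialForm (κ l) fun k => ((u l k : ℝ) : ℂ)).eval Complex.I = 0 := by
        rw [eval_binomialForm]
        exact sum_eq_zero fun k hk => by
          rw [hl k (Nat.lt_succ_iff.1 (mem_range.1 hk)), Complex.ofReal_zero, mul_zero, zero_mul]
      have := (hu l _ hJ).1
      simp at this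
  · rintro ⟨c, u, hc, hu, hb⟩
    refine ⟨(c : ℂ), u, by exact_mod_cast hc, fun i t ht => ?_, fun α hα => ?_⟩
    · have := hu i t ht
      simpa using this
    · rw [hb α hα, Complex.ofReal_mul, Complex.ofReal_prod]

/-- **Theorem 4.5, (a) ⇒ (c), outside the degenerate range**: if `λ` is a `κ`-multiplier sequence with at least
three nonzero terms on the box, then `T[(z+w)^κ] ∈ 𝓗_{2n}(ℝ)` or `T[(z-w)^κ] ∈ 𝓗_{2n}(ℝ)`. Proof: by Theorem 4.4
(tree: `BorceaBranden_realStabilityPreserver_iff'`) the only other possibility is `T = α(·)P + β(·)Q` of rank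
`≤ 2`, impossible with three independent monomials `λ(α_k) z^{α_k}` in the range. (With at most two nonzero terms
Theorem 4.4 (a) can occur, e.g. `λ ≡ 0`; the printed statement tacitly excludes this.)
[cite: BorceaBranden2009II, §4 Thm. 4.5 ((a) ⇒ (c)), Thm. 4.4] -/
theorem realStable_symbol_or_neg_of_isMultiplierSeq {κ : τ → ℕ} {lam : (τ →₀ ℕ) → ℝ}
    (h : IsMultiplierSeq κ lam) {α₁ α₂ α₃ : τ →₀ ℕ} (h₁ : α₁ ≤ toF κ) (h₂ : α₂ ≤ toF κ) (h₃ : α₃ ≤ toF κ)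
    (h12 : α₁ ≠ α₂) (h13 : α₁ ≠ α₃) (h23 : α₂ ≠ α₃) (hl₁ : lam α₁ ≠ 0) (hl₂ : lam α₂ ≠ 0) (hl₃ : lam α₃ ≠ 0) :
    IsRealStable (realBoundedDegreeSymbol κ (mvMultiplierOp lam)) ∨
      IsRealStable (realBoundedDegreeSymbolNeg κ (mvMultiplierOp lam)) := by
  rcases (BorceaBranden_realStabilityPreserver_iff' κ (mvMultiplierOp lam)).1 h with ⟨a, b, P, Q, -, -, -, hT⟩ | hc
  · exfalso
    -- the three monomials
    have hdeg : ∀ {α : τ →₀ ℕ}, α ≤ toF κ → ∀ i, degreeOf i (monomial α (1 : ℝ)) ≤ κ i := by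
      intro α hα i
      rw [degreeOf_monomial_eq _ _ one_ne_zero]
      have := Finsupp.le_def.1 hα i; rwa [toF_apply] at this
    have hv : ∀ {α : τ →₀ ℕ}, α ≤ toF κ →
        (monomial α (lam α) : MvPolynomial τ ℝ) = a (monomial α 1) • P + b (monomial α 1) • Q := by
      intro α hα
      rw [← hT _ (hdeg hα), mvMultiplierOp_monomial, mul_one]
    have e1 := hv h₁
    have e2 := hv h₂
    have e3 := hv h₃
    -- the `2 × 2` minors vanish: a dependency of the three coefficient vectors gives a dependency of monomials
    set a1 := a (monomial α₁ 1); set b1 := b (monomial α₁ 1)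
    set a2 := a (monomial α₂ 1); set b2 := b (monomial α₂ 1)
    set a3 := a (monomial α₃ 1); set b3 := b (monomial α₃ 1)
    have hcomb : (a2 * b3 - a3 * b2) • (monomial α₁ (lam α₁) : MvPolynomial τ ℝ) +
        (a3 * b1 - a1 * b3) • monomial α₂ (lam α₂) + (a1 * b2 - a2 * b1) • monomial α₃ (lam α₃) = 0 := by
      rw [e1, e2, e3]
      simp only [smul_add, smul_smul]
      have hP : ((a2 * b3 - a3 * b2) * a1) • P + ((a3 * b1 - a1 * b3) * a2) • P + ((a1 * b2 - a2 * b1) * a3) • P = 0 := by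
        rw [← add_smul, ← add_smul, show (a2 * b3 - a3 * b2) * a1 + (a3 * b1 - a1 * b3) * a2 +
          (a1 * b2 - a2 * b1) * a3 = 0 by ring, zero_smul]
      have hQ : ((a2 * b3 - a3 * b2) * b1) • Q + ((a3 * b1 - a1 * b3) * b2) • Q + ((a1 * b2 - a2 * b1) * b3) • Q = 0 := by
        rw [← add_smul, ← add_smul, show (a2 * b3 - a3 * b2) * b1 + (a3 * b1 - a1 * b3) * b2 +
          (a1 * b2 - a2 * b1) * b3 = 0 by ring, zero_smul]
      calc _ = (((a2 * b3 - a3 * b2) * a1) • P + ((a3 * b1 - a1 * b3) * a2) • P + ((a1 * b2 - a2 * b1) * a3) • P) +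
          (((a2 * b3 - a3 * b2) * b1) • Q + ((a3 * b1 - a1 * b3) * b2) • Q + ((a1 * b2 - a2 * b1) * b3) • Q) := by
            abel
        _ = 0 := by rw [hP, hQ, add_zero]
    have hmin : ∀ {β₁ β₂ β₃ : τ →₀ ℕ} {c₁ c₂ c₃ l₁ l₂ l₃ : ℝ}, β₁ ≠ β₂ → β₁ ≠ β₃ → l₁ ≠ 0 →
        c₁ • (monomial β₁ l₁ : MvPolynomial τ ℝ) + c₂ • monomial β₂ l₂ + c₃ • monomial β₃ l₃ = 0 → c₁ = 0 := by
      intro β₁ β₂ β₃ c₁ c₂ c₃ l₁ l₂ l₃ hb12 hb13 hl1 hsum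
      have := congrArg (coeff β₁) hsum
      rw [coeff_add, coeff_add, coeff_smul, coeff_smul, coeff_smul, coeff_monomial, coeff_monomial, coeff_monomial,
        if_pos rfl, if_neg (Ne.symm hb12), if_neg (Ne.symm hb13), coeff_zero, smul_zero, smul_zero, add_zero,
        add_zero, smul_eq_mul] at this
      exact (mul_eq_zero.1 this).resolve_right hl1
    have m1 : a2 * b3 - a3 * b2 = 0 := hmin h12 h13 hl₁ hcomb
    have m2 : a3 * b1 - a1 * b3 = 0 := hmin (Ne.symm h12) h23 hl₂ (by
      rw [show (a3 * b1 - a1 * b3) • (monomial α₂ (lam α₂) : MvPolynomial τ ℝ) +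
        (a2 * b3 - a3 * b2) • monomial α₁ (lam α₁) + (a1 * b2 - a2 * b1) • monomial α₃ (lam α₃) =
        (a2 * b3 - a3 * b2) • monomial α₁ (lam α₁) + (a3 * b1 - a1 * b3) • monomial α₂ (lam α₂) +
        (a1 * b2 - a2 * b1) • monomial α₃ (lam α₃) by abel]
      exact hcomb)
    have m3 : a1 * b2 - a2 * b1 = 0 := hmin (Ne.symm h13) (Ne.symm h23) hl₃ (by
      rw [show (a1 * b2 - a2 * b1) • (monomial α₃ (lam α₃) : MvPolynomial τ ℝ) +
        (a2 * b3 - a3 * b2) • monomial α₁ (lam α₁) + (a3 * b1 - a1 * b3) • monomial α₂ (lam α₂) =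
        (a2 * b3 - a3 * b2) • monomial α₁ (lam α₁) + (a3 * b1 - a1 * b3) • monomial α₂ (lam α₂) +
        (a1 * b2 - a2 * b1) • monomial α₃ (lam α₃) by abel]
      exact hcomb)
    -- with `a1 b2 = a2 b1`: `b2 v1 - b1 v2 = 0` and `a2 v1 - a1 v2 = 0`
    have hb21 : b2 • (monomial α₁ (lam α₁) : MvPolynomial τ ℝ) + (-b1) • monomial α₂ (lam α₂) +
        (0 : ℝ) • monomial α₃ (lam α₃) = 0 := by
      rw [e1, e2, zero_smul, add_zero, smul_add, smul_add, smul_smul, smul_smul, smul_smul, smul_smul]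
      calc (b2 * a1) • P + (b2 * b1) • Q + ((-b1 * a2) • P + (-b1 * b2) • Q)
          = (b2 * a1 + -b1 * a2) • P + (b2 * b1 + -b1 * b2) • Q := by rw [add_smul, add_smul]; abel
        _ = 0 := by rw [show b2 * a1 + -b1 * a2 = a1 * b2 - a2 * b1 by ring, m3,
              show b2 * b1 + -b1 * b2 = 0 by ring, zero_smul, zero_smul, add_zero]
    have ha21 : a2 • (monomial α₁ (lam α₁) : MvPolynomial τ ℝ) + (-a1) • monomial α₂ (lam α₂) +
        (0 : ℝ) • monomial α₃ (lam α₃) = 0 := by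
      rw [e1, e2, zero_smul, add_zero, smul_add, smul_add, smul_smul, smul_smul, smul_smul, smul_smul]
      calc (a2 * a1) • P + (a2 * b1) • Q + ((-a1 * a2) • P + (-a1 * b2) • Q)
          = (a2 * a1 + -a1 * a2) • P + (a2 * b1 + -a1 * b2) • Q := by rw [add_smul, add_smul]; abel
        _ = 0 := by rw [show a2 * a1 + -a1 * a2 = 0 by ring, show a2 * b1 + -a1 * b2 = -(a1 * b2 - a2 * b1) by ring,
              m3, neg_zero, zero_smul, zero_smul, add_zero]
    have hb2 : b2 = 0 := hmin h12 h13 hl₁ hb21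
    have ha2 : a2 = 0 := hmin h12 h13 hl₁ ha21
    -- then `v2 = 0`, contradicting `λ(α₂) ≠ 0`
    have : (monomial α₂ (lam α₂) : MvPolynomial τ ℝ) = 0 := by
      rw [e2]
      rw [ha2, hb2, zero_smul, zero_smul, add_zero]
    exact hl₂ (monomial_eq_zero.1 this)
  · exact hc

/-- **Borcea–Brändén II, Theorem 4.5 (hard multivariate Pólya–Schur), for sequences with at least three nonzero
terms on the box.** For `λ = {λ(α)}_{α ≤ κ}` real and `T(z^α) = λ(α)z^α` on `ℝ_κ[z]`, the following are
equivalent: (a) `λ` is a `κ`-multiplier sequence; (c) `T[(z+w)^κ] ∈ 𝓗_{2n}(ℝ)` or `T[(z-w)^κ] ∈ 𝓗_{2n}(ℝ)`;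
(b)/(d) `λ(α) = C Π_i λ_i(α_i)` (`C ≠ 0`) where the Jensen polynomials `Σ_k binom(κ_i,k) λ_i(k) t^k` have only
real zeros, either all `≤ 0` for every `i` or all `≥ 0` for every `i`. The equivalence (c) ⇔ (b)/(d) and the
implication (c) ⇒ (a) hold without the non-degeneracy assumption (`isRealStable_symbol_iff_prod`,
`isRealStable_symbolNeg_iff_prod`, `isMultiplierSeq_of_symbol`). [cite: BorceaBranden2009II, §4 Thm. 4.5] -/
theorem BorceaBranden_hardPolyaSchur {κ : τ → ℕ} {lam : (τ →₀ ℕ) → ℝ} {α₁ α₂ α₃ : τ →₀ ℕ} (h₁ : α₁ ≤ toF κ)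
    (h₂ : α₂ ≤ toF κ) (h₃ : α₃ ≤ toF κ) (h12 : α₁ ≠ α₂) (h13 : α₁ ≠ α₃) (h23 : α₂ ≠ α₃) (hl₁ : lam α₁ ≠ 0)
    (hl₂ : lam α₂ ≠ 0) (hl₃ : lam α₃ ≠ 0) :
    (IsMultiplierSeq κ lam ↔
      (IsRealStable (realBoundedDegreeSymbol κ (mvMultiplierOp lam)) ∨
        IsRealStable (realBoundedDegreeSymbolNeg κ (mvMultiplierOp lam)))) ∧
    (IsMultiplierSeq κ lam ↔
      ∃ (c : ℝ) (u : τ → ℕ → ℝ), c ≠ 0 ∧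
        ((∀ i (t : ℂ), (binomialForm (κ i) fun k => ((u i k : ℝ) : ℂ)).eval t = 0 → t.im = 0 ∧ t.re ≤ 0) ∨
          (∀ i (t : ℂ), (binomialForm (κ i) fun k => ((u i k : ℝ) : ℂ)).eval t = 0 → t.im = 0 ∧ 0 ≤ t.re)) ∧
        ∀ α : τ →₀ ℕ, α ≤ toF κ → lam α = c * ∏ i, u i (α i)) := by
  have hac : IsMultiplierSeq κ lam ↔ (IsRealStable (realBoundedDegreeSymbol κ (mvMultiplierOp lam)) ∨
      IsRealStable (realBoundedDegreeSymbolNeg κ (mvMultiplierOp lam))) :=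
    ⟨fun h => realStable_symbol_or_neg_of_isMultiplierSeq h h₁ h₂ h₃ h12 h13 h23 hl₁ hl₂ hl₃,
      isMultiplierSeq_of_symbol⟩
  refine ⟨hac, ?_⟩
  rw [hac, isRealStable_symbol_iff_prod, isRealStable_symbolNeg_iff_prod]
  constructor
  · rintro (⟨c, u, hc, hu, hb⟩ | ⟨c, u, hc, hu, hb⟩)
    · exact ⟨c, u, hc, Or.inl hu, hb⟩
    · exact ⟨c, u, hc, Or.inr hu, hb⟩
  · rintro ⟨c, u, hc, hu | hu, hb⟩
    · exact Or.inl ⟨c, u, hc, hu, hb⟩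
    · exact Or.inr ⟨c, u, hc, hu, hb⟩

/-- **Remark 4.1: "the `κ`-multiplier sequences with constant sign are precisely the sequences whose corresponding
operators preserve stability"** — the direction available from Theorem 3.1: if `T[(z+w)^κ]` is real stable (the
"non-negative" case of Theorem 4.5) then `T` preserves stability on `ℂ_κ[z]`. [cite: BorceaBranden2009II, §4
Remark 4.1, §3 Thm. 3.1] -/
theorem stable_or_zero_of_isRealStable_symbol {κ : τ → ℕ} {lam : (τ →₀ ℕ) → ℝ}
    (h : IsRealStable (realBoundedDegreeSymbol κ (mvMultiplierOp lam))) {p : MvPolynomial τ ℂ}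
    (hp : ∀ i, degreeOf i p ≤ κ i) (hs : IsUpperHalfPlaneStable p) :
    IsUpperHalfPlaneStable (mvMultiplierOp (fun s => ((lam s : ℝ) : ℂ)) p) ∨
      mvMultiplierOp (fun s => ((lam s : ℝ) : ℂ)) p = 0 := by
  rw [IsRealStable, map_realBoundedDegreeSymbol, complexify_mvMultiplierOp] at h
  exact (BorceaBranden_stabilityPreserver_iff' κ _).2 (Or.inr h) p hp hs

end Theorem45

/-! ## §5 Corollary 4.6 -/

section Corollary46

variable [Fintype τ] [DecidableEq τ]

/-- A diagonal operator of the rank-one form `T = α(·)P` on `ℂ_κ[z]` has at most one nonzero multiplier on the box.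
[cite: BorceaBranden2009II, §3 Thm. 3.2 (a), §4 Cor. 4.6] -/
theorem atMostOne_of_rankOne {κ : τ → ℕ} {b : (τ →₀ ℕ) → ℂ} {a : MvPolynomial τ ℂ →ₗ[ℂ] ℂ}
    {P : MvPolynomial τ ℂ} (hT : ∀ p : MvPolynomial τ ℂ, (∀ i, degreeOf i p ≤ κ i) → mvMultiplierOp b p = a p • P)
    {α₁ α₂ : τ →₀ ℕ} (h₁ : α₁ ≤ toF κ) (h₂ : α₂ ≤ toF κ) (h12 : α₁ ≠ α₂) : b α₁ = 0 ∨ b α₂ = 0 := by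
  by_contra hne
  push Not at hne
  have hdeg : ∀ {α : τ →₀ ℕ}, α ≤ toF κ → ∀ i, degreeOf i (monomial α (1 : ℂ)) ≤ κ i := by
    intro α hα i
    rw [degreeOf_monomial_eq _ _ one_ne_zero]
    have := Finsupp.le_def.1 hα i; rwa [toF_apply] at this
  have e1 : (monomial α₁ (b α₁) : MvPolynomial τ ℂ) = a (monomial α₁ 1) • P := by
    rw [← hT _ (hdeg h₁), mvMultiplierOp_monomial, mul_one]
  have e2 : (monomial α₂ (b α₂) : MvPolynomial τ ℂ) = a (monomial α₂ 1) • P := by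
    rw [← hT _ (hdeg h₂), mvMultiplierOp_monomial, mul_one]
  have ha1 : a (monomial α₁ 1) ≠ 0 := fun h0 => hne.1 (monomial_eq_zero.1 (by rw [e1, h0, zero_smul]))
  have key : a (monomial α₂ 1) • (monomial α₁ (b α₁) : MvPolynomial τ ℂ) = a (monomial α₁ 1) • monomial α₂ (b α₂) := by
    rw [e1, e2, smul_smul, smul_smul, mul_comm]
  have := congrArg (coeff α₁) key
  rw [coeff_smul, coeff_smul, coeff_monomial, coeff_monomial, if_pos rfl, if_neg (Ne.symm h12), smul_zero,
    smul_eq_mul] at this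
  rcases mul_eq_zero.1 this with h | h
  · exact hne.2 (monomial_eq_zero.1 (by rw [e2, h, zero_smul]))
  · exact hne.1 h

/-- **Borcea–Brändén II, Corollary 4.6.** "Let `κ ∈ ℕⁿ`, `λ = {λ(α)}_{α ≤ κ}` be a sequence of complex numbers
and `T : ℂ_κ[z] → ℂ_κ[z]` be the corresponding linear operator. Then `T` preserves weak Hurwitz stability if and only
if `λ` is (a constant complex multiple of) a non-negative `κ`-multiplier sequence." Here the right-hand side is
spelled out through Theorem 4.5 (b)/(d): either `λ ≡ 0` on the box (the multiple `0`), or `λ(α) = C Π_i u_i(α_i)` on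
the box with `C ≠ 0` and real `u_i` whose Jensen polynomials `Σ_{k ≤ κ_i} binom(κ_i,k) u_i(k) t^k` have only real
zeros `≤ 0`. Proof as printed: Theorem 3.2 (tree: `BorceaBranden_rightHalfPlaneStabilityPreserver_iff`), the symbol
`T[(1+zw)^κ] = Σ binom(κ,α) λ(α) z^α w^α`, the rotation to `Σ (-1)^α binom(κ,α) λ(α) z^α w^α`, Lemma 4.3 (both
directions); the degenerate rank-one alternative of Theorem 3.2 gives the case `λ ≡ 0`.
[cite: BorceaBranden2009II, §4 Cor. 4.6] -/
theorem BorceaBranden_weaklyHurwitzMultiplier_iff (κ : τ → ℕ) (b : (τ →₀ ℕ) → ℂ) :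
    (∀ p : MvPolynomial τ ℂ, (∀ i, degreeOf i p ≤ κ i) → IsHThetaStable (Real.pi / 2) p →
        IsHThetaStable (Real.pi / 2) (mvMultiplierOp b p) ∨ mvMultiplierOp b p = 0) ↔
      (∀ α : τ →₀ ℕ, α ≤ toF κ → b α = 0) ∨
        ∃ (c : ℂ) (u : τ → ℕ → ℝ), c ≠ 0 ∧
          (∀ i (t : ℂ), (binomialForm (κ i) fun k => ((u i k : ℝ) : ℂ)).eval t = 0 → t.im = 0 ∧ t.re ≤ 0) ∧
          ∀ α : τ →₀ ℕ, α ≤ toF κ → b α = c * ∏ i, ((u i (α i) : ℝ) : ℂ) := by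
  rw [BorceaBranden_rightHalfPlaneStabilityPreserver_iff]
  have hprod : IsHThetaStable (Real.pi / 2) (boundedDegreeSymbolD κ (mvMultiplierOp b)) ↔
      ∃ (c : ℂ) (u : τ → ℕ → ℝ), c ≠ 0 ∧
        (∀ i (t : ℂ), (binomialForm (κ i) fun k => ((u i k : ℝ) : ℂ)).eval t = 0 → t.im = 0 ∧ t.re ≤ 0) ∧
        ∀ α : τ →₀ ℕ, α ≤ toF κ → b α = c * ∏ i, ((u i (α i) : ℝ) : ℂ) := by
    rw [boundedDegreeSymbolD_mvMultiplierOp, isHThetaStable_diagSubst_binomTwist_iff,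
      show ((-1 : ℂ)) = ((-1 : ℝ) : ℂ) by norm_num, isUpperHalfPlaneStable_diagSubst_binomTwist_iff κ (Or.inr rfl)]
    simp only [neg_mul, one_mul, neg_nonneg]
  constructor
  · rintro (⟨a, P, -, hT⟩ | hG)
    · -- rank one: at most one nonzero multiplier on the box
      by_cases h0 : ∀ α : τ →₀ ℕ, α ≤ toF κ → b α = 0
      · exact Or.inl h0
      · push Not at h0
        obtain ⟨α₀, hα₀, hb₀⟩ := h0
        refine Or.inr ⟨b α₀, fun i k => if k = α₀ i then 1 else 0, hb₀, fun i t ht => ?_, fun α hα => ?_⟩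
        · -- the Jensen polynomial is `binom(κ_i,α₀_i) t^{α₀_i}`
          have hle : α₀ i ≤ κ i := by have := Finsupp.le_def.1 hα₀ i; rwa [toF_apply] at this
          rw [eval_binomialForm, sum_eq_single (α₀ i) (fun k _ hk => by simp [hk])
            (fun h => absurd (mem_range.2 (Nat.lt_succ_of_le hle)) h)] at ht
          have ht' : (((κ i).choose (α₀ i) : ℕ) : ℂ) * t ^ α₀ i = 0 := by simpa using ht
          rcases mul_eq_zero.1 ht' with h0 | h0
          · exact absurd (Nat.cast_eq_zero.1 h0) (Nat.choose_pos hle).ne'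
          · obtain ⟨ht0, -⟩ := pow_eq_zero_iff'.1 h0
            rw [ht0]; simp
        · by_cases hαα : α = α₀
          · subst hαα; simp
          · rcases atMostOne_of_rankOne hT hα hα₀ hαα with h | h
            · rw [h]
              obtain ⟨i, hi⟩ : ∃ i, α i ≠ α₀ i := by
                by_contra hcon; push Not at hcon; exact hαα (Finsupp.ext hcon)
              rw [prod_eq_zero (mem_univ i) (by simp [hi]), mul_zero]
            · exact absurd h hb₀
    · exact Or.inr (hprod.1 hG)
  · rintro (h0 | h)
    · -- `λ ≡ 0` on the box: `T = 0` on `ℂ_κ[z]`, of the rank-one form with `α = 0`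
      refine Or.inl ⟨0, 1, by
        rw [isHThetaStable_pi_div_two_iff]; intro z _; rw [map_one]; exact one_ne_zero, fun p hp => ?_⟩
      rw [LinearMap.zero_apply, zero_smul, eq_sum_box hp, map_sum]
      refine sum_eq_zero fun m hm => ?_
      rw [map_smul, mvMultiplierOp_prod_X_pow,
        h0 _ (Finsupp.le_def.2 fun i => by rw [toF_apply, toF_apply]; exact mem_box_iff.1 hm i), zero_smul,
        smul_zero]
    · exact Or.inr (hprod.2 h)

/-- **Corollary 4.6, necessity in the form (uik) of §8.5** (the `TODO(general form)` of `WagnerTheorem.lean`): if a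
diagonal operator `T(z^α) = λ(α) z^α` preserves weak Hurwitz stability on `ℂ_κ[z]` and does not annihilate `ℂ_κ[z]`,
then `λ(α) = C Π_i u_i(α_i)` on the box with each `Σ_k binom(κ_i,k) u_i(k) z^k` having only real non-positive zeros.
[cite: BorceaBranden2009II, §4 Cor. 4.6, §8.5 (uik)] -/
theorem exists_prod_of_weaklyHurwitzStabilityPreserver {κ : τ → ℕ} {b : (τ →₀ ℕ) → ℂ}
    (h : ∀ p : MvPolynomial τ ℂ, (∀ i, degreeOf i p ≤ κ i) → IsHThetaStable (Real.pi / 2) p →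
      IsHThetaStable (Real.pi / 2) (mvMultiplierOp b p) ∨ mvMultiplierOp b p = 0)
    (hne : ∃ α : τ →₀ ℕ, α ≤ toF κ ∧ b α ≠ 0) :
    ∃ (c : ℂ) (u : τ → ℕ → ℝ), c ≠ 0 ∧
      (∀ i (t : ℂ), (binomialForm (κ i) fun k => ((u i k : ℝ) : ℂ)).eval t = 0 → t.im = 0 ∧ t.re ≤ 0) ∧
      ∀ α : τ →₀ ℕ, α ≤ toF κ → b α = c * ∏ i, ((u i (α i) : ℝ) : ℂ) := by
  rcases (BorceaBranden_weaklyHurwitzMultiplier_iff κ b).1 h with h0 | h1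
  · obtain ⟨α, hα, hb⟩ := hne
    exact absurd (h0 α hα) hb
  · exact h1

end Corollary46

end Literature.Combinatorics.StablePolynomials

end
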